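import Literature.MathematicalPhysics.KineticTheory.HardSphereEuler
import HarnessLib

/-!
# Serre's collision estimate for hard spheres in a periodic box (compensated integrability)

Named fact requested by route `AtomisticToContinuum/HydrodynamicLimit/CompensatedSlabClusters`
(crux item `SerrePeriodicPayload`, stmt-AtomisticToContinuum-9051; work item wi-19716):
**Serre's weighted collision estimate on the torus** — D. Serre, *Compensated integrability on
tori; a priori estimate for space-periodic gas flows*, C. R. Math. 362 (2024) 1425–1444, §1.4
Theorem 6 with estimate (7), proved in §5 as estimates (19)–(20):

> (19) There exists `θ(d) > 0` such that, whenever `N a < θ(d)`, `Σ_coll |[v]| ≤_d N (√(N E) + E T)`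
> for hard-sphere motions over `(0, T) × 𝕋ᵈ` (`𝕋ᵈ = (ℝ/2πℤ)ᵈ`, `N` balls of radius `a` per cell,
> `E = Σ_p ½|v_p|²` the kinetic energy per cell, a constant of the motion, `[v] = v⁺(p) − v⁻(p)` the
> velocity jump of a particle of the colliding pair, the sum running over all collisions in `(0, T)`);
> (20) for `L𝕋ᵈ`-periodic configurations, `Σ_coll |[v]| ≤_d N (√(N E) + E T / L)` whenever
> `N a < θ(d) L`.

The motions considered are those with binary collisions that do not accumulate (§1.4: "As long as
the collisions involve only pairs of particles, and infinitely many collisions do not accumulate,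
the dynamics can be continued in a unique manner; these are the motions that we consider"), i.e.
exactly the tree's `Literature.Analysis.FluidPDE.IsHardSphereTrajectory` (binary collisions from
incoming configurations, locally finitely many collision times, elastic reflection, free flight).

**Transcription to the tree's hard-sphere vocabulary** (`HardSpherePhaseSpace`, `HardSphereDynamics`,
`KineticTheory.T3 = UnitAddTorus (Fin 3)`), `d = 3`: the unit flat torus `ℝ³/ℤ³` is `L𝕋³` with
`L = 1/(2π)`; spheres of DIAMETER `ε` are balls of radius `a = ε/2`, so Serre's hypothesis
`N a < θ(3) L` reads `K ε < κ := θ(3)/π`; the right-continuous trajectory `γ` has velocity jumps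
`(γ t i).2 − (leftLim γ t i).2`, non-zero exactly for the two particles of the pair colliding at
`t` (one pair per collision time, `IsHardSphereTrajectory.binary`), both of size `|[v]|`
(conservation of momentum, equal masses), so the tree's payload
`Σ_{t ∈ collisionTimes ∩ [a,b]} Σ_i ‖v_i(t) − v_i(t⁻)‖` is `2 Σ_coll |[v]|`; a global trajectory
restricted to the windows `(a − δ, b + δ)`, `δ → 0⁺`, gives the closed window `[a, b]` (the
right-hand side of (20) is continuous in `T = b − a + 2δ`); `E = configEnergy (γ a) = ½ Σ_i ‖v_i‖²`
(any Galilean frame: the proof of (18)–(20), §5 (16)–(17), uses only that `E` is the conserved kinetic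
energy; the zero-momentum frame of §5 only serves to write (7) in terms of the r.m.s. velocity).
Hence (20) gives the statement below with `c = 4π C₃`. The constants `κ`, `c` are universal
(`d = 3` fixed). For `K ≤ 1` there are no collisions and the bound is trivial.

What is NOT here: compensated integrability itself (Serre 2024 Thm. 3, Thm. 11; the
mass–momentum tensor and determinantal masses of §5), the whole-space estimate
`Σ_coll |[v]| ≤_d N² v̄` (Serre 2024 (5), from Serre's 2021 ARMA paper [Serre2021]), and the
"further estimate" on `Σ_nodes |v⁻ ∧ v⁺|` (p. 1440).

## References

* D. Serre, *Compensated integrability on tori; a priori estimate for space-periodic gas flows*,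
  C. R. Math. Acad. Sci. Paris 362 (2024) 1425–1444, doi:10.5802/crmath.654: §1.4, Thm. 6 and (7)
  (pp. 1430–1431); §5, (15)–(20) (pp. 1438–1440) (read from the held copy). [Serre2024]
* D. Serre, *Hard spheres dynamics: weak vs strong collisions*, Arch. Ration. Mech. Anal. 240
  (2021) 243–264, arXiv:2002.09157: Thm. 1.1 (whole space `ℝⁿ`: "assume (generic) that the
  collision set is finite on every band `(0, τ) × ℝⁿ`, and that the motion involves only binary
  collisions … `Σ_kinks (v̄ |v' − v| + |v ∧ v'|) ≤ c_n N² v̄²`, where the sum runs over the particles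
  and the collisions they experience"; the construction cited as [12] in Serre 2024). [Serre2021]
-/

noncomputable section

namespace Literature.MathematicalPhysics.KineticTheory

open Literature.Analysis.FluidPDE

/-- **Serre's periodic collision (payload) bound for hard spheres** (Serre 2024, Thm. 6 / (7),
proved as (19)–(20): `Σ_coll |[v]| ≤_d N (√(N E) + E T / L)` on `(0, T) × L𝕋ᵈ` whenever
`N a < θ(d) L`), transcribed to `K` spheres of diameter `ε` on the unit flat torus `𝕋³ = ℝ³/ℤ³`
with the tree's right-continuous hard-sphere trajectories (module docstring: `L = 1/(2π)`,
`a = ε/2`, both kinks of a collision counted, closed time window by approximation,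
`E = configEnergy (γ a)` in the given frame): there are universal `κ > 0` and `c` such that for all
`K`, all `ε > 0` with `K ε < κ`, every hard-sphere trajectory `γ` of `K` spheres of diameter `ε` on
`𝕋³` and all `a ≤ b`,
`Σ_{t ∈ collisionTimes ∩ [a, b]} Σ_i ‖(γ t i).2 − (leftLim γ t i).2‖ ≤ c (K^{3/2} E^{1/2} + (b − a) K E)`.
The Lean statement is literally the route decl
`Summit.AtomisticToContinuum.HydrodynamicLimit.Theses.CompensatedSlabClusters.SerrePeriodicPayload`.
[cite: Serre2024, Thm. 6 with (7), §1.4; (19)–(20), §5 p. 1440] -/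
def SerrePeriodicPayloadBound : Prop :=
  ∃ κ : ℝ, 0 < κ ∧ ∃ c : ℝ, ∀ (K : ℕ) (ε : ℝ), 0 < ε → (K : ℝ) * ε < κ →
    ∀ γ : ℝ → Config K (Fin 3) T3, IsHardSphereTrajectory (Torus.geometry (Fin 3)) ε K γ →
      ∀ a b : ℝ, a ≤ b →
        (∑ᶠ t ∈ collisionTimes (Torus.geometry (Fin 3)) ε γ ∩ Set.Icc a b,
            ∑ i : Fin K, ‖(γ t i).2 - (Function.leftLim γ t i).2‖) ≤
          c * ((K : ℝ) ^ ((3 : ℝ) / 2) * Real.sqrt (configEnergy (γ a)) +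
            (b - a) * (K : ℝ) * configEnergy (γ a))

/-- The payload bound at a single trajectory, with the constants of `SerrePeriodicPayloadBound`
extracted (convenience form for consumers holding `h : SerrePeriodicPayloadBound`). [folklore] -/
theorem SerrePeriodicPayloadBound.exists_forall (h : SerrePeriodicPayloadBound) :
    ∃ κ c : ℝ, 0 < κ ∧ ∀ (K : ℕ) (ε : ℝ), 0 < ε → (K : ℝ) * ε < κ →
      ∀ γ : ℝ → Config K (Fin 3) T3, IsHardSphereTrajectory (Torus.geometry (Fin 3)) ε K γ →
        ∀ a b : ℝ, a ≤ b →
          (∑ᶠ t ∈ collisionTimes (Torus.geometry (Fin 3)) ε γ ∩ Set.Icc a b,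
              ∑ i : Fin K, ‖(γ t i).2 - (Function.leftLim γ t i).2‖) ≤
            c * ((K : ℝ) ^ ((3 : ℝ) / 2) * Real.sqrt (configEnergy (γ a)) +
              (b - a) * (K : ℝ) * configEnergy (γ a)) := by
  obtain ⟨κ, hκ, c, h⟩ := h
  exact ⟨κ, c, hκ, h⟩

/-- With no collision in the window the payload vanishes, so the bound holds there as soon as the
right-hand side is non-negative (e.g. `c ≥ 0`); in particular the fact is consistent with
collision-free motions. [folklore] -/
theorem payload_eq_zero_of_disjoint {K : ℕ} {ε : ℝ} (γ : ℝ → Config K (Fin 3) T3) {a b : ℝ}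
    (h : collisionTimes (Torus.geometry (Fin 3)) ε γ ∩ Set.Icc a b = ∅) :
    (∑ᶠ t ∈ collisionTimes (Torus.geometry (Fin 3)) ε γ ∩ Set.Icc a b,
        ∑ i : Fin K, ‖(γ t i).2 - (Function.leftLim γ t i).2‖) = 0 := by
  rw [h, finsum_mem_empty]

end Literature.MathematicalPhysics.KineticTheory

end
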